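import Summits.QuantumFields.BalabanUV.Beta.FP.TorusStepInsertionSymTwo
import Summits.QuantumFields.BalabanUV.Beta.FP.TorusCompositeCovarianceOneSym

/-!
# `BalabanUV.Beta.FP.TorusCompositeCovarianceTwoPolarSym` — road «FP» for binder row D1, ROUTE T, (β1) RE-BASING (ROW RULING R-D1-g52-1 (3)(c)), **(COV-m)
# ORDER 2 FOR THE (0.4)-SYMMETRISED TOWER, POLARISED — THE SYMMETRIC BILINEAR COMPANIONS `stepIns₂₂Sym w w′` (R-19) ∕ `compIns₂₂Sym … n h h′` OF THE SYM ONE-STEP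
# AND COMPOSITE SECOND JETS**: the sym composite bi-jet by the ♭ second chain rule over leaf-06's `compRowsSym`, its diagonal `compIns₂Sym` (the sym twin of
# I-4's `compIns₂`), SYMMETRY (the sym pair swap at generic `d`), BILINEARITY, and the polarisation identity — the sym twin of leaf-02 g26's
# `TorusCompositeCovarianceTwoPolar` (defs + §1–§2; the gauge-covariance LAWS `c2 ∕ d2` are NOT here)

WHY.  Every order-2 consumer of the (β1) tower — the sym passes of R-8 ∕ R-10 ∕ R-14 ∕ R-17 (the order-2 junction: `compIns₂₂Sym` acts on periodic forms
through R-19's `sum_stepIns₂₂Sym_mul_periodic`), the `-Sym` door's `Q₁₂ := c² • compIns₂Sym …` binding, an2's F5 record instance — reads the composite sym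
bi-jet by its RECURSION.  This file types that recursion (generic `d`, no gauge law needed) and its algebra; the one-step order-2 covariance law and the
composite `c2 ∕ d2` rows (contact supplier at `d = 3` over an1's packaged `symVh₂SAn1 3 Lc`, g30 W-5 l.56372) follow in separate files.

WHAT (generic `d`; blocking `Lc`, `[NeZero Lc]`; `hc : ctrOff (d+1) Lc ∈ box (d+1) Lc` displayed where a support letter reads the centred root).
* §1 ONE STEP (R-19's `stepIns₂₂Sym`): bilinearity (finite sums); the sym PAIR SWAP at generic `d` — `dper_symBorderT2_apply` (an2's `dper_apply_of_periodCov` +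
  R-19's `symBorderT2_periodCov`), `tsum_tsum_symPair_comm_inr_inl` (finite-rectangle Fubini over R-19's `symPair_inr_inl_eq_zero_of_not_mem`),
  `dper_symBorderT2_swap_inr_inl`, `submatrix_perF_dper_symBorderT2_swap`, **`stepIns₂₂Sym_comm (hc)`**; R-18's first jet is linear: `stepIns₁Sym_add ∕ _smul`.
* §2 THE TOWER: `compIns₁Sym_add ∕ _smul`; [our object — bookkeeping] **`compIns₂₂Sym Lc M lev rs n h h′`** — `0` at depth `0`; at depth `n+1`: `(θ_n∕σ_n) •
  stepIns₂₂Sym (C h) (C h′) · C + θ_n • (stepIns₁Sym (C h) · compIns₁Sym h′ + stepIns₁Sym (C h′) · compIns₁Sym h) + QstepSym · compIns₂₂Sym^{low} h h′` (`C :=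
  compRowsSym^{low}`; TwoPolar's `compIns₂₂` VERBATIM under the (β1) substitution, same scalars); [our object — bookkeeping] **`compIns₂Sym … n h := compIns₂₂Sym
  … n h h`** (the sym twin of I-4's `compIns₂`, DEFINED as the diagonal; `compIns₂₂Sym_self` by `rfl`); `compIns₂₂Sym_zero ∕ _succ` (`rfl`), **`compIns₂Sym_succ`**
  (I-4's ♭ shape with the `2 •` cross term), `compIns₂Sym_one`; **`compIns₂₂Sym_comm (hc)`**, **`compIns₂₂Sym_add_left ∕ _smul_left`** (induction), `_add_right ∕
  _smul_right` (by symmetry), **`compIns₂Sym_add`** (polarisation).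
NOT HERE: the order-2 covariance laws (`stepIns₂Sym_mul_tgrad`, `compIns₂Sym_mul_tgrad`, rows `c2 ∕ d2`); R-8's sym pass; any chart; any estimate.  [our object —
bookkeeping] two defs + [folklore] finite sums ∕ finitely supported `tsum` re-indexing BY NAME over OUR bookkeeping objects and an1's typed tables; no `def … : Prop`,
nothing cited, 0 sorry, default heartbeats.  Nothing of the dictionary ∕ Bałaban's non-linear averages asserted (that the re-based composite's second variation IS
this ♭ chain rule is the ROW's (β1) ruling and an2's (C1) TABLE word, quoted); NO chart fixed; the (C1) TABLES, the seven letters, `hH ∕ hQ` untouched.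

HONEST DEPENDENCY (page 1, mandatory): continuum YM on T⁴ ⇐ BetaPertH ∧ nine spine estimates (0/9 proved); BetaPertH ⇐ (D1) ∧ (D4) ∧ CAP+tail;
G-an2-4 gates asym, D1 and NE2/3/4.  HONEST FRAMING (cell contract, verbatim): «discharging `BetaPertH` makes Bałaban's UV stability UNCONDITIONAL —
a real constructive-QFT result; it is NOT the continuum limit and NOT the Clay problem.»  ABSOLUTE RULE (cell charter, verbatim): «No internally-minted
statement may enter as a cited fact. Every hypothesis is either kernel-proved in this package or a verbatim quotation of a PUBLISHED theorem with page
reference. The manuscript(s) under audit are NOT citable for their own disputed steps — they are the thing under adjudication; programme-internal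
(2001/route/tribunal) claims are never citable.»  0 estimates; 0∕4 row-D1 binders (hW, hR, D1Tel, D1Rep); NOT (T-ID), NOT (C1), NOT SDF, NOT D1,
NOT BetaPertH, NOT continuum, NOT Clay.  D1 formalisation swarm LEAF PROVER 02 (b2b-balaban-beta-d1-formalise-leaf-02 gen 32), 2026-08-24.  No existing file touched.
-/

noncomputable section

open scoped BigOperators

namespace Summit.QuantumFields.BalabanUV.Beta.FP.TorusCompositeCovarianceTwoPolarSym

open Matrix Finset
open Literature.MathematicalPhysics.QuantumFieldTheory
open Literature.MathematicalPhysics.QuantumFieldTheory.Balaban1983to89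
open Literature.MathematicalPhysics.QuantumFieldTheory.Balaban1983to89.Beta
open B5Prop11Plancherel (fine)
open B6Lemma24Torus (pbox mem_pbox)
open B4TorusKernel.MultiPeriod (translate translate_apply translate_injective)
open Summit.QuantumFields.BalabanUV.Beta.GAN24.DirichletExhaustionPeriodise (one_le_M)
open ExpKernelCalculus (MKer)
open AffineAveraging (Site box toSite unitVec)
open AveragingContoursRooted (ctr ctrOff)
open OneStepResolventKernel (Fib)
open Summit.QuantumFields.BalabanUV.Beta.BorderedHessian (stepScale)
open Summit.QuantumFields.BalabanUV.Beta.SymAveragingMixedJetTables (symVh₂SAt)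
open Summit.QuantumFields.BalabanUV.Beta.CombWilsonT2Periodised (dper_apply_of_periodCov)
open Summit.QuantumFields.BalabanUV.Beta.CombWilsonT2PeriodisedK2 (tsum_tsum_comm_of_support)
open Summit.QuantumFields.BalabanUV.Beta.FP.KernelPeriodisationFib (Idx perF perF_apply perZ perZ_apply)
open Summit.QuantumFields.BalabanUV.Beta.FP.KernelPeriodisationFibLoc (dper)
open Summit.QuantumFields.BalabanUV.Beta.FP.TorusGaugeCovariance (nearBox)
open Summit.QuantumFields.BalabanUV.Beta.FP.TorusGaugeCovarianceCoarse (coarsePt)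
open Summit.QuantumFields.BalabanUV.Beta.FP.TorusCompositeObjects
open Summit.QuantumFields.BalabanUV.Beta.FP.TorusCompositeObjectsG (QstepSym QSym compRowsSym)
open Summit.QuantumFields.BalabanUV.Beta.FP.TorusStepInsertionSym (stepIns₁Sym)
open Summit.QuantumFields.BalabanUV.Beta.FP.TorusStepInsertionSymTwo (stepIns₂₂Sym stepIns₂Sym symBorderT2_periodCov symPair_inr_inl_eq_zero_of_not_mem)
open Summit.QuantumFields.BalabanUV.Beta.FP.TorusCompositeCovarianceOneSym (compIns₁Sym compIns₁Sym_zero)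

variable {d : ℕ}

section OneStep -- §1 One step: bilinearity and SYMMETRY of R-19's sym bi-jet; linearity of R-18's sym first jet

variable (M : Fin (d + 1) → ℕ) [∀ μ, NeZero (M μ)] (Lc : ℕ) [NeZero Lc]

omit [∀ μ, NeZero (M μ)] in
/-- [folklore] R-18's sym first jet is additive in the direction. -/
theorem stepIns₁Sym_add (w w' : ↥(pbox (fine Lc M)) × Fin (d + 1) → ℝ) :
    stepIns₁Sym M Lc (w + w') = stepIns₁Sym M Lc w + stepIns₁Sym M Lc w' := by
  simp only [stepIns₁Sym, Pi.add_apply, add_smul, Finset.sum_add_distrib]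

omit [∀ μ, NeZero (M μ)] in
/-- [folklore] R-18's sym first jet is homogeneous in the direction. -/
theorem stepIns₁Sym_smul (a : ℝ) (w : ↥(pbox (fine Lc M)) × Fin (d + 1) → ℝ) :
    stepIns₁Sym M Lc (a • w) = a • stepIns₁Sym M Lc w := by
  simp only [stepIns₁Sym, Pi.smul_apply, smul_eq_mul, mul_smul, Finset.smul_sum]

omit [∀ μ, NeZero (M μ)] in
/-- [folklore] additive in the first weight. -/
theorem stepIns₂₂Sym_add_left (w₁ w₂ w' : ↥(pbox (fine Lc M)) × Fin (d + 1) → ℝ) :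
    stepIns₂₂Sym M Lc (w₁ + w₂) w' = stepIns₂₂Sym M Lc w₁ w' + stepIns₂₂Sym M Lc w₂ w' := by
  simp only [stepIns₂₂Sym, Pi.add_apply, add_mul, add_smul, Finset.sum_add_distrib]

omit [∀ μ, NeZero (M μ)] in
/-- [folklore] homogeneous in the first weight. -/
theorem stepIns₂₂Sym_smul_left (a : ℝ) (w w' : ↥(pbox (fine Lc M)) × Fin (d + 1) → ℝ) :
    stepIns₂₂Sym M Lc (a • w) w' = a • stepIns₂₂Sym M Lc w w' := by
  simp only [stepIns₂₂Sym, Pi.smul_apply, smul_eq_mul, mul_assoc, mul_smul, Finset.smul_sum]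

omit [∀ μ, NeZero (M μ)] in
/-- [folklore] additive in the second weight. -/
theorem stepIns₂₂Sym_add_right (w w₁ w₂ : ↥(pbox (fine Lc M)) × Fin (d + 1) → ℝ) :
    stepIns₂₂Sym M Lc w (w₁ + w₂) = stepIns₂₂Sym M Lc w w₁ + stepIns₂₂Sym M Lc w w₂ := by
  simp only [stepIns₂₂Sym, Pi.add_apply, mul_add, add_smul, Finset.sum_add_distrib]

omit [∀ μ, NeZero (M μ)] in
/-- [folklore] homogeneous in the second weight. -/
theorem stepIns₂₂Sym_smul_right (a : ℝ) (w w' : ↥(pbox (fine Lc M)) × Fin (d + 1) → ℝ) :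
    stepIns₂₂Sym M Lc w (a • w') = a • stepIns₂₂Sym M Lc w w' := by
  simp only [stepIns₂₂Sym, Pi.smul_apply, smul_eq_mul, mul_left_comm _ a, mul_smul, Finset.smul_sum]

omit [∀ μ, NeZero (M μ)] in
/-- [folklore] **THE SYM MEMBER's KERNEL IS THE DOUBLE COPY SUM** (`T = fine Lc M`): `dper T (W κ′ u′ κ u) x z a c = Σ'_m Σ'_n ½(S κ (u+T∘m) κ′ (u′+T∘n) + S κ′
(u′+T∘n) κ (u+T∘m)) x z a c`, `S := symVh₂SAt (ctr (d+1) Lc) Lc` (an2's `dper_apply_of_periodCov` + R-19's `symBorderT2_periodCov`). -/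
theorem dper_symBorderT2_apply {W : Fin (d + 1) → Site (d + 1) → Fin (d + 1) → Site (d + 1) → MKer (d + 1) (Fib d)}
    (hW : W = fun κ' u' κ u x z a c => ∑' n : Site (d + 1), (1 / 2 : ℝ) * (symVh₂SAt (ctr (d + 1) Lc) Lc κ u κ' (translate (fine Lc M) u' n) x z a c
      + symVh₂SAt (ctr (d + 1) Lc) Lc κ' (translate (fine Lc M) u' n) κ u x z a c))
    (κ' : Fin (d + 1)) (u' : Site (d + 1)) (κ : Fin (d + 1)) (u x z : Site (d + 1)) (a c : Fib d) :
    dper (fine Lc M) (W κ' u' κ u) x z a c = ∑' m : Site (d + 1), ∑' n : Site (d + 1), (1 / 2 : ℝ) *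
      (symVh₂SAt (ctr (d + 1) Lc) Lc κ (translate (fine Lc M) u m) κ' (translate (fine Lc M) u' n) x z a c
        + symVh₂SAt (ctr (d + 1) Lc) Lc κ' (translate (fine Lc M) u' n) κ (translate (fine Lc M) u m) x z a c) := by
  have hV : W κ' u' = fun κ u x z a c => ∑' n : Site (d + 1), (1 / 2 : ℝ) *
      (symVh₂SAt (ctr (d + 1) Lc) Lc κ u κ' (translate (fine Lc M) u' n) x z a c + symVh₂SAt (ctr (d + 1) Lc) Lc κ' (translate (fine Lc M) u' n) κ u x z a c) := by
    rw [hW]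
  rw [dper_apply_of_periodCov (W κ' u') (symBorderT2_periodCov M Lc κ' u' hV) κ u x z a c, hV]

/-- [folklore] the double copy sum commutes on the `(inr μ, inl α)` block (both copy indices range over the finite window `nearBox Lc (blk Lc x)` — R-19's support
letter `symPair_inr_inl_eq_zero_of_not_mem` in either bond; centred root `hc`). -/
theorem tsum_tsum_symPair_comm_inr_inl (hc : ctrOff (d + 1) Lc ∈ box (d + 1) Lc) (κ : Fin (d + 1)) (u : Site (d + 1)) (κ' : Fin (d + 1)) (u' x z : Site (d + 1)) (μ α : Fin (d + 1)) :
    ∑' m : Site (d + 1), ∑' n : Site (d + 1), (1 / 2 : ℝ) * (symVh₂SAt (ctr (d + 1) Lc) Lc κ (translate (fine Lc M) u m) κ' (translate (fine Lc M) u' n) x z (Sum.inr μ) (Sum.inl α)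
        + symVh₂SAt (ctr (d + 1) Lc) Lc κ' (translate (fine Lc M) u' n) κ (translate (fine Lc M) u m) x z (Sum.inr μ) (Sum.inl α))
      = ∑' n : Site (d + 1), ∑' m : Site (d + 1), (1 / 2 : ℝ) * (symVh₂SAt (ctr (d + 1) Lc) Lc κ (translate (fine Lc M) u m) κ' (translate (fine Lc M) u' n) x z (Sum.inr μ) (Sum.inl α)
        + symVh₂SAt (ctr (d + 1) Lc) Lc κ' (translate (fine Lc M) u' n) κ (translate (fine Lc M) u m) x z (Sum.inr μ) (Sum.inl α)) := by
  classical
  exact tsum_tsum_comm_of_support (fun m n => (1 / 2 : ℝ) * (symVh₂SAt (ctr (d + 1) Lc) Lc κ (translate (fine Lc M) u m) κ' (translate (fine Lc M) u' n) x z (Sum.inr μ) (Sum.inl α)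
      + symVh₂SAt (ctr (d + 1) Lc) Lc κ' (translate (fine Lc M) u' n) κ (translate (fine Lc M) u m) x z (Sum.inr μ) (Sum.inl α)))
    ((nearBox Lc (AveragingContours.blk Lc x)).preimage (fun m => translate (fine Lc M) u m) (translate_injective (one_le_M (fine Lc M)) u).injOn)
    ((nearBox Lc (AveragingContours.blk Lc x)).preimage (fun n => translate (fine Lc M) u' n) (translate_injective (one_le_M (fine Lc M)) u').injOn)
    (fun _ hm _ => symPair_inr_inl_eq_zero_of_not_mem Lc hc κ _ κ' _ x z μ α (Or.inr (Or.inl fun h => hm (Finset.mem_preimage.2 h))))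
    (fun _ hn _ => symPair_inr_inl_eq_zero_of_not_mem Lc hc κ _ κ' _ x z μ α (Or.inr (Or.inr fun h => hn (Finset.mem_preimage.2 h))))

/-- [folklore] **PAIR SYMMETRY OF THE SYM TORUS MEMBER ON THE `(inr, inl)` BLOCK**: `dper T (W κ′ u′ κ u) x z (inr μ) (inl α) = dper T (W κ u κ′ u′) x z (inr μ)
(inl α)` — the pair is symmetrised copy by copy, so only the two copy sums are exchanged (finite-rectangle Fubini); no anti-twin, no other block. -/
theorem dper_symBorderT2_swap_inr_inl (hc : ctrOff (d + 1) Lc ∈ box (d + 1) Lc)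
    {W : Fin (d + 1) → Site (d + 1) → Fin (d + 1) → Site (d + 1) → MKer (d + 1) (Fib d)}
    (hW : W = fun κ' u' κ u x z a c => ∑' n : Site (d + 1), (1 / 2 : ℝ) * (symVh₂SAt (ctr (d + 1) Lc) Lc κ u κ' (translate (fine Lc M) u' n) x z a c
      + symVh₂SAt (ctr (d + 1) Lc) Lc κ' (translate (fine Lc M) u' n) κ u x z a c))
    (κ' : Fin (d + 1)) (u' : Site (d + 1)) (κ : Fin (d + 1)) (u x z : Site (d + 1)) (μ α : Fin (d + 1)) :
    dper (fine Lc M) (W κ' u' κ u) x z (Sum.inr μ) (Sum.inl α) = dper (fine Lc M) (W κ u κ' u') x z (Sum.inr μ) (Sum.inl α) := by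
  rw [dper_symBorderT2_apply M Lc hW, dper_symBorderT2_apply M Lc hW, tsum_tsum_symPair_comm_inr_inl M Lc hc κ u κ' u' x z μ α]
  exact tsum_congr fun n => tsum_congr fun m => by ring

/-- [folklore] pair symmetry at the matrix level: `T^{b,b′}_sym = T^{b′,b}_sym` in any multiplier presentation `a ↦ (pμ a, inr (mμ a))`. -/
theorem submatrix_perF_dper_symBorderT2_swap (hc : ctrOff (d + 1) Lc ∈ box (d + 1) Lc)
    {W : Fin (d + 1) → Site (d + 1) → Fin (d + 1) → Site (d + 1) → MKer (d + 1) (Fib d)}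
    (hW : W = fun κ' u' κ u x z a c => ∑' n : Site (d + 1), (1 / 2 : ℝ) * (symVh₂SAt (ctr (d + 1) Lc) Lc κ u κ' (translate (fine Lc M) u' n) x z a c
      + symVh₂SAt (ctr (d + 1) Lc) Lc κ' (translate (fine Lc M) u' n) κ u x z a c))
    {κI : Type*} (pμ : κI → Site (d + 1)) (hpμ : ∀ a, pμ a ∈ pbox (fine Lc M)) (mμ : κI → Fin (d + 1)) (b b' : ↥(pbox (fine Lc M)) × Fin (d + 1)) :
    (perF (fine Lc M) (dper (fine Lc M) (W b'.2 (b'.1 : Site (d + 1)) b.2 (b.1 : Site (d + 1))))).submatrix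
          (fun a : κI => ((⟨pμ a, hpμ a⟩, Sum.inr (mμ a)) : Idx (fine Lc M) (Fib d)))
          (fun c : ↥(pbox (fine Lc M)) × Fin (d + 1) => ((c.1, Sum.inl c.2) : Idx (fine Lc M) (Fib d)))
      = (perF (fine Lc M) (dper (fine Lc M) (W b.2 (b.1 : Site (d + 1)) b'.2 (b'.1 : Site (d + 1))))).submatrix
          (fun a : κI => ((⟨pμ a, hpμ a⟩, Sum.inr (mμ a)) : Idx (fine Lc M) (Fib d)))
          (fun c : ↥(pbox (fine Lc M)) × Fin (d + 1) => ((c.1, Sum.inl c.2) : Idx (fine Lc M) (Fib d))) := by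
  ext a c
  simp only [Matrix.submatrix_apply, perF_apply, perZ_apply]
  exact tsum_congr fun m => dper_symBorderT2_swap_inr_inl M Lc hc hW _ _ _ _ _ _ _ _

/-- [folklore] **SYMMETRIC** (centred root `hc`): `stepIns₂₂Sym w w′ = stepIns₂₂Sym w′ w` — the sym pair swap at R-19's slot maps, then `Finset.sum_comm`. -/
theorem stepIns₂₂Sym_comm (hc : ctrOff (d + 1) Lc ∈ box (d + 1) Lc) (w w' : ↥(pbox (fine Lc M)) × Fin (d + 1) → ℝ) :
    stepIns₂₂Sym M Lc w w' = stepIns₂₂Sym M Lc w' w := by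
  obtain ⟨W, hW⟩ : ∃ W : Fin (d + 1) → Site (d + 1) → Fin (d + 1) → Site (d + 1) → MKer (d + 1) (Fib d),
      W = fun κ' u' κ u x z a c => ∑' n : Site (d + 1), (1 / 2 : ℝ) * (symVh₂SAt (ctr (d + 1) Lc) Lc κ u κ' (translate (fine Lc M) u' n) x z a c
        + symVh₂SAt (ctr (d + 1) Lc) Lc κ' (translate (fine Lc M) u' n) κ u x z a c) := ⟨_, rfl⟩
  have hS : ∀ v v' : ↥(pbox (fine Lc M)) × Fin (d + 1) → ℝ, stepIns₂₂Sym M Lc v v'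
      = ∑ b : ↥(pbox (fine Lc M)) × Fin (d + 1), ∑ b' : ↥(pbox (fine Lc M)) × Fin (d + 1), (v b * v' b') •
          (perF (fine Lc M) (dper (fine Lc M) (W b'.2 (b'.1 : Site (d + 1)) b.2 (b.1 : Site (d + 1))))).submatrix
            (fun a : ↥(pbox M) × Fin (d + 1) => (((⟨(coarsePt M Lc a.1 : Site (d + 1)), (coarsePt M Lc a.1).2⟩ : ↥(pbox (fine Lc M))), Sum.inr a.2) : Idx (fine Lc M) (Fib d)))
            (fun c : ↥(pbox (fine Lc M)) × Fin (d + 1) => ((c.1, Sum.inl c.2) : Idx (fine Lc M) (Fib d))) := fun v v' => by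
    subst hW; rfl
  rw [hS, hS, Finset.sum_comm]
  refine Finset.sum_congr rfl fun b' _ => Finset.sum_congr rfl fun b _ => ?_
  rw [mul_comm, submatrix_perF_dper_symBorderT2_swap M Lc hc hW
    (fun a : ↥(pbox M) × Fin (d + 1) => (coarsePt M Lc a.1 : Site (d + 1))) (fun a => (coarsePt M Lc a.1).2) (fun a => a.2) b' b]

end OneStep

section Tower -- §2 The sym tower: the composite bilinear companion, its diagonal, symmetry, bilinearity, polarisation

variable (Lc : ℕ) [NeZero Lc]

/-- [folklore] R-21's sym composite first jet is additive in the direction, THE INDUCTION STEP (push-inside types). -/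
theorem compIns₁Sym_add_step (n : ℕ) (M : Fin (d + 1) → ℕ) [∀ μ, NeZero (M μ)] (lev : ℕ → ℕ) (rs : ℕ → (Fin (d + 1) → ℕ))
    (h h' : ↥(pbox (towerTorus Lc (fine Lc M) n)) × Fin (d + 1) → ℝ)
    (ih : compIns₁Sym Lc (fine Lc M) (fun k => lev (k + 1)) (fun k => rs (k + 1)) n (h + h')
      = compIns₁Sym Lc (fine Lc M) (fun k => lev (k + 1)) (fun k => rs (k + 1)) n h + compIns₁Sym Lc (fine Lc M) (fun k => lev (k + 1)) (fun k => rs (k + 1)) n h') :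
    (((Lc : ℝ) ^ (d + 1) * stepScale d Lc (lev 1)) * (∏ i ∈ range n, (stepScale d Lc (lev (i + 1 + 1)) * ((box (d + 1) Lc).card : ℝ)))⁻¹) •
          (stepIns₁Sym M Lc (compRowsSym Lc (fine Lc M) (fun k => lev (k + 1)) (fun k => rs (k + 1)) n *ᵥ (h + h'))
            * compRowsSym Lc (fine Lc M) (fun k => lev (k + 1)) (fun k => rs (k + 1)) n)
        + QstepSym Lc M (lev 1) * compIns₁Sym Lc (fine Lc M) (fun k => lev (k + 1)) (fun k => rs (k + 1)) n (h + h')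
      = (((Lc : ℝ) ^ (d + 1) * stepScale d Lc (lev 1)) * (∏ i ∈ range n, (stepScale d Lc (lev (i + 1 + 1)) * ((box (d + 1) Lc).card : ℝ)))⁻¹) •
            (stepIns₁Sym M Lc (compRowsSym Lc (fine Lc M) (fun k => lev (k + 1)) (fun k => rs (k + 1)) n *ᵥ h)
              * compRowsSym Lc (fine Lc M) (fun k => lev (k + 1)) (fun k => rs (k + 1)) n)
          + QstepSym Lc M (lev 1) * compIns₁Sym Lc (fine Lc M) (fun k => lev (k + 1)) (fun k => rs (k + 1)) n h
        + ((((Lc : ℝ) ^ (d + 1) * stepScale d Lc (lev 1)) * (∏ i ∈ range n, (stepScale d Lc (lev (i + 1 + 1)) * ((box (d + 1) Lc).card : ℝ)))⁻¹) •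
            (stepIns₁Sym M Lc (compRowsSym Lc (fine Lc M) (fun k => lev (k + 1)) (fun k => rs (k + 1)) n *ᵥ h')
              * compRowsSym Lc (fine Lc M) (fun k => lev (k + 1)) (fun k => rs (k + 1)) n)
          + QstepSym Lc M (lev 1) * compIns₁Sym Lc (fine Lc M) (fun k => lev (k + 1)) (fun k => rs (k + 1)) n h') := by
  rw [ih, Matrix.mulVec_add, stepIns₁Sym_add, Matrix.add_mul, smul_add, Matrix.mul_add]
  abel

/-- [folklore] `compIns₁Sym` is additive in the direction. -/
theorem compIns₁Sym_add :
    ∀ (n : ℕ) (M : Fin (d + 1) → ℕ) [∀ μ, NeZero (M μ)] (lev : ℕ → ℕ) (rs : ℕ → (Fin (d + 1) → ℕ))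
      (h h' : ↥(pbox (towerTorus Lc M n)) × Fin (d + 1) → ℝ),
      compIns₁Sym Lc M lev rs n (h + h') = compIns₁Sym Lc M lev rs n h + compIns₁Sym Lc M lev rs n h'
  | 0, M, _, lev, rs, h, h' => by simp only [compIns₁Sym_zero, add_zero]
  | n + 1, M, _, lev, rs, h, h' => compIns₁Sym_add_step Lc n M lev rs h h' (compIns₁Sym_add n (fine Lc M) (fun k => lev (k + 1)) (fun k => rs (k + 1)) h h')

/-- [folklore] homogeneity, THE INDUCTION STEP (push-inside types). -/
theorem compIns₁Sym_smul_step (n : ℕ) (M : Fin (d + 1) → ℕ) [∀ μ, NeZero (M μ)] (lev : ℕ → ℕ) (rs : ℕ → (Fin (d + 1) → ℕ)) (a : ℝ)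
    (h : ↥(pbox (towerTorus Lc (fine Lc M) n)) × Fin (d + 1) → ℝ)
    (ih : compIns₁Sym Lc (fine Lc M) (fun k => lev (k + 1)) (fun k => rs (k + 1)) n (a • h)
      = a • compIns₁Sym Lc (fine Lc M) (fun k => lev (k + 1)) (fun k => rs (k + 1)) n h) :
    (((Lc : ℝ) ^ (d + 1) * stepScale d Lc (lev 1)) * (∏ i ∈ range n, (stepScale d Lc (lev (i + 1 + 1)) * ((box (d + 1) Lc).card : ℝ)))⁻¹) •
          (stepIns₁Sym M Lc (compRowsSym Lc (fine Lc M) (fun k => lev (k + 1)) (fun k => rs (k + 1)) n *ᵥ (a • h))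
            * compRowsSym Lc (fine Lc M) (fun k => lev (k + 1)) (fun k => rs (k + 1)) n)
        + QstepSym Lc M (lev 1) * compIns₁Sym Lc (fine Lc M) (fun k => lev (k + 1)) (fun k => rs (k + 1)) n (a • h)
      = a • ((((Lc : ℝ) ^ (d + 1) * stepScale d Lc (lev 1)) * (∏ i ∈ range n, (stepScale d Lc (lev (i + 1 + 1)) * ((box (d + 1) Lc).card : ℝ)))⁻¹) •
            (stepIns₁Sym M Lc (compRowsSym Lc (fine Lc M) (fun k => lev (k + 1)) (fun k => rs (k + 1)) n *ᵥ h)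
              * compRowsSym Lc (fine Lc M) (fun k => lev (k + 1)) (fun k => rs (k + 1)) n)
          + QstepSym Lc M (lev 1) * compIns₁Sym Lc (fine Lc M) (fun k => lev (k + 1)) (fun k => rs (k + 1)) n h) := by
  rw [ih, Matrix.mulVec_smul, stepIns₁Sym_smul, Matrix.smul_mul, Matrix.mul_smul, smul_add, smul_comm a]

/-- [folklore] `compIns₁Sym` is homogeneous in the direction. -/
theorem compIns₁Sym_smul :
    ∀ (n : ℕ) (M : Fin (d + 1) → ℕ) [∀ μ, NeZero (M μ)] (lev : ℕ → ℕ) (rs : ℕ → (Fin (d + 1) → ℕ)) (a : ℝ)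
      (h : ↥(pbox (towerTorus Lc M n)) × Fin (d + 1) → ℝ),
      compIns₁Sym Lc M lev rs n (a • h) = a • compIns₁Sym Lc M lev rs n h
  | 0, M, _, lev, rs, a, h => by simp only [compIns₁Sym_zero, smul_zero]
  | n + 1, M, _, lev, rs, a, h => compIns₁Sym_smul_step Lc n M lev rs a h (compIns₁Sym_smul n (fine Lc M) (fun k => lev (k + 1)) (fun k => rs (k + 1)) a h)

/-- [our object — bookkeeping] **THE COMPOSITE SECOND-ORDER INSERTION BI-JET OF THE (0.4)-SYMMETRISED `n`-FOLD AVERAGING ALONG TWO BOND WEIGHTS `h, h′` — the ♭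
second chain rule, POLARISED** (push-inside recursion; TwoPolar's `compIns₂₂` VERBATIM under the (β1) substitution): `0` at depth `0`; at depth `n+1`:
`(θ_n∕σ_n) • stepIns₂₂Sym (C h) (C h′) · C + θ_n • (stepIns₁Sym (C h) · compIns₁Sym h′ + stepIns₁Sym (C h′) · compIns₁Sym h) + QstepSym · compIns₂₂Sym^{low} h h′`,
`C := compRowsSym^{low}`, `θ_n = Lc^{d+1}·stepScale d Lc (lev 1) ∕ σ_n`, `σ_n = ∏_{i<n} stepScale d Lc (lev (i+2))·#B`. -/
def compIns₂₂Sym : (M : Fin (d + 1) → ℕ) → [∀ μ, NeZero (M μ)] → (lev : ℕ → ℕ) → (rs : ℕ → (Fin (d + 1) → ℕ)) → (n : ℕ) →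
    ((↥(pbox (towerTorus Lc M n)) × Fin (d + 1) → ℝ)) → ((↥(pbox (towerTorus Lc M n)) × Fin (d + 1) → ℝ)) →
      Matrix (↥(pbox M) × Fin (d + 1)) (↥(pbox (towerTorus Lc M n)) × Fin (d + 1)) ℝ
  | _, _, _, _, 0, _, _ => 0
  | M, _, lev, rs, n + 1, h, h' =>
    ((((Lc : ℝ) ^ (d + 1) * stepScale d Lc (lev 1)) * (∏ i ∈ range n, (stepScale d Lc (lev (i + 1 + 1)) * ((box (d + 1) Lc).card : ℝ)))⁻¹) * (∏ i ∈ range n, (stepScale d Lc (lev (i + 1 + 1)) * ((box (d + 1) Lc).card : ℝ)))⁻¹) •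
            (stepIns₂₂Sym M Lc (compRowsSym Lc (fine Lc M) (fun k => lev (k + 1)) (fun k => rs (k + 1)) n *ᵥ h) (compRowsSym Lc (fine Lc M) (fun k => lev (k + 1)) (fun k => rs (k + 1)) n *ᵥ h') * compRowsSym Lc (fine Lc M) (fun k => lev (k + 1)) (fun k => rs (k + 1)) n)
        + (((Lc : ℝ) ^ (d + 1) * stepScale d Lc (lev 1)) * (∏ i ∈ range n, (stepScale d Lc (lev (i + 1 + 1)) * ((box (d + 1) Lc).card : ℝ)))⁻¹) • (stepIns₁Sym M Lc (compRowsSym Lc (fine Lc M) (fun k => lev (k + 1)) (fun k => rs (k + 1)) n *ᵥ h) * compIns₁Sym Lc (fine Lc M) (fun k => lev (k + 1)) (fun k => rs (k + 1)) n h' + stepIns₁Sym M Lc (compRowsSym Lc (fine Lc M) (fun k => lev (k + 1)) (fun k => rs (k + 1)) n *ᵥ h') * compIns₁Sym Lc (fine Lc M) (fun k => lev (k + 1)) (fun k => rs (k + 1)) n h)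
        + QstepSym Lc M (lev 1) * compIns₂₂Sym (fine Lc M) (fun k => lev (k + 1)) (fun k => rs (k + 1)) n h h'

/-- [our object — bookkeeping] **THE COMPOSITE SECOND-ORDER INSERTION JET OF THE (0.4)-SYMMETRISED `n`-FOLD AVERAGING ALONG ONE BOND WEIGHT `h`** — the DIAGONAL of
the bi-jet (the sym twin of I-4's `compIns₂`, here DEFINED as the diagonal; its ♭ recursion shape is `compIns₂Sym_succ`). -/
def compIns₂Sym (M : Fin (d + 1) → ℕ) [∀ μ, NeZero (M μ)] (lev : ℕ → ℕ) (rs : ℕ → (Fin (d + 1) → ℕ)) (n : ℕ) (h : ↥(pbox (towerTorus Lc M n)) × Fin (d + 1) → ℝ) :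
    Matrix (↥(pbox M) × Fin (d + 1)) (↥(pbox (towerTorus Lc M n)) × Fin (d + 1)) ℝ := compIns₂₂Sym Lc M lev rs n h h

/-- unfolding, depth `0`. -/
@[simp] theorem compIns₂₂Sym_zero (M : Fin (d + 1) → ℕ) [∀ μ, NeZero (M μ)] (lev : ℕ → ℕ) (rs : ℕ → (Fin (d + 1) → ℕ)) (h h' : ↥(pbox M) × Fin (d + 1) → ℝ) :
    compIns₂₂Sym Lc M lev rs 0 h h' = 0 := rfl

/-- unfolding, depth `n+1` (`rfl`). -/
theorem compIns₂₂Sym_succ (M : Fin (d + 1) → ℕ) [∀ μ, NeZero (M μ)] (lev : ℕ → ℕ) (rs : ℕ → (Fin (d + 1) → ℕ)) (n : ℕ) (h h' : ↥(pbox (towerTorus Lc (fine Lc M) n)) × Fin (d + 1) → ℝ) :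
    compIns₂₂Sym Lc M lev rs (n + 1) h h'
      = ((((Lc : ℝ) ^ (d + 1) * stepScale d Lc (lev 1)) * (∏ i ∈ range n, (stepScale d Lc (lev (i + 1 + 1)) * ((box (d + 1) Lc).card : ℝ)))⁻¹) * (∏ i ∈ range n, (stepScale d Lc (lev (i + 1 + 1)) * ((box (d + 1) Lc).card : ℝ)))⁻¹) •
            (stepIns₂₂Sym M Lc (compRowsSym Lc (fine Lc M) (fun k => lev (k + 1)) (fun k => rs (k + 1)) n *ᵥ h) (compRowsSym Lc (fine Lc M) (fun k => lev (k + 1)) (fun k => rs (k + 1)) n *ᵥ h') * compRowsSym Lc (fine Lc M) (fun k => lev (k + 1)) (fun k => rs (k + 1)) n)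
        + (((Lc : ℝ) ^ (d + 1) * stepScale d Lc (lev 1)) * (∏ i ∈ range n, (stepScale d Lc (lev (i + 1 + 1)) * ((box (d + 1) Lc).card : ℝ)))⁻¹) • (stepIns₁Sym M Lc (compRowsSym Lc (fine Lc M) (fun k => lev (k + 1)) (fun k => rs (k + 1)) n *ᵥ h) * compIns₁Sym Lc (fine Lc M) (fun k => lev (k + 1)) (fun k => rs (k + 1)) n h' + stepIns₁Sym M Lc (compRowsSym Lc (fine Lc M) (fun k => lev (k + 1)) (fun k => rs (k + 1)) n *ᵥ h') * compIns₁Sym Lc (fine Lc M) (fun k => lev (k + 1)) (fun k => rs (k + 1)) n h)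
        + QstepSym Lc M (lev 1) * compIns₂₂Sym Lc (fine Lc M) (fun k => lev (k + 1)) (fun k => rs (k + 1)) n h h' := rfl

/-- [folklore] the diagonal of the sym bi-jet IS the sym second jet (`rfl`; the sym twin of TwoPolar's `compIns₂₂_self`). -/
theorem compIns₂₂Sym_self (M : Fin (d + 1) → ℕ) [∀ μ, NeZero (M μ)] (lev : ℕ → ℕ) (rs : ℕ → (Fin (d + 1) → ℕ)) (n : ℕ) (h : ↥(pbox (towerTorus Lc M n)) × Fin (d + 1) → ℝ) :
    compIns₂₂Sym Lc M lev rs n h h = compIns₂Sym Lc M lev rs n h := rfl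

/-- unfolding the diagonal, depth `0`. -/
@[simp] theorem compIns₂Sym_zero (M : Fin (d + 1) → ℕ) [∀ μ, NeZero (M μ)] (lev : ℕ → ℕ) (rs : ℕ → (Fin (d + 1) → ℕ)) (h : ↥(pbox M) × Fin (d + 1) → ℝ) :
    compIns₂Sym Lc M lev rs 0 h = 0 := rfl

/-- [folklore] **THE ♭ SECOND CHAIN RULE OF THE SYM SECOND JET** (the sym twin of I-4's `compIns₂_succ`, obtained from the polarised recursion on the diagonal:
`θ•(T₁·I₁ + T₁·I₁) = 2θ•(T₁·I₁)`): at depth `n+1`, `(θ_n∕σ_n) • stepIns₂Sym (C h) · C + 2θ_n • stepIns₁Sym (C h) · compIns₁Sym h + QstepSym · compIns₂Sym^{low} h`. -/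
theorem compIns₂Sym_succ (M : Fin (d + 1) → ℕ) [∀ μ, NeZero (M μ)] (lev : ℕ → ℕ) (rs : ℕ → (Fin (d + 1) → ℕ)) (n : ℕ) (h : ↥(pbox (towerTorus Lc (fine Lc M) n)) × Fin (d + 1) → ℝ) :
    compIns₂Sym Lc M lev rs (n + 1) h
      = ((((Lc : ℝ) ^ (d + 1) * stepScale d Lc (lev 1)) * (∏ i ∈ range n, (stepScale d Lc (lev (i + 1 + 1)) * ((box (d + 1) Lc).card : ℝ)))⁻¹)
            * (∏ i ∈ range n, (stepScale d Lc (lev (i + 1 + 1)) * ((box (d + 1) Lc).card : ℝ)))⁻¹) •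
            (stepIns₂Sym M Lc ((compRowsSym Lc (fine Lc M) (fun k => lev (k + 1)) (fun k => rs (k + 1)) n) *ᵥ h)
              * compRowsSym Lc (fine Lc M) (fun k => lev (k + 1)) (fun k => rs (k + 1)) n)
        + ((2 : ℝ) * (((Lc : ℝ) ^ (d + 1) * stepScale d Lc (lev 1)) * (∏ i ∈ range n, (stepScale d Lc (lev (i + 1 + 1)) * ((box (d + 1) Lc).card : ℝ)))⁻¹)) •
            (stepIns₁Sym M Lc ((compRowsSym Lc (fine Lc M) (fun k => lev (k + 1)) (fun k => rs (k + 1)) n) *ᵥ h)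
              * compIns₁Sym Lc (fine Lc M) (fun k => lev (k + 1)) (fun k => rs (k + 1)) n h)
        + QstepSym Lc M (lev 1) * compIns₂Sym Lc (fine Lc M) (fun k => lev (k + 1)) (fun k => rs (k + 1)) n h := by
  rw [compIns₂Sym, compIns₂₂Sym_succ, two_mul, add_smul, smul_add]
  rfl

/-- the one-fold sym composite second jet is the sym one-step second jet with `θ_0 = c_{lev 1}⁻¹`:
`compIns₂Sym … 1 h = (Lc^{d+1}·stepScale d Lc (lev 1)) • stepIns₂Sym M Lc h`. -/
theorem compIns₂Sym_one (M : Fin (d + 1) → ℕ) [∀ μ, NeZero (M μ)] (lev : ℕ → ℕ) (rs : ℕ → (Fin (d + 1) → ℕ)) (h : ↥(pbox (fine Lc M)) × Fin (d + 1) → ℝ) :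
    compIns₂Sym Lc M lev rs 1 h = ((Lc : ℝ) ^ (d + 1) * stepScale d Lc (lev 1)) • stepIns₂Sym M Lc h := by
  let I : Matrix (↥(pbox (fine Lc M)) × Fin (d + 1)) (↥(pbox (fine Lc M)) × Fin (d + 1)) ℝ := 1
  let O : Matrix (↥(pbox (fine Lc M)) × Fin (d + 1)) (↥(pbox (fine Lc M)) × Fin (d + 1)) ℝ := 0
  show ((((Lc : ℝ) ^ (d + 1) * stepScale d Lc (lev 1)) * (∏ i ∈ range 0, (stepScale d Lc (lev (i + 1 + 1)) * ((box (d + 1) Lc).card : ℝ)))⁻¹)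
          * (∏ i ∈ range 0, (stepScale d Lc (lev (i + 1 + 1)) * ((box (d + 1) Lc).card : ℝ)))⁻¹) • (stepIns₂₂Sym M Lc (I *ᵥ h) (I *ᵥ h) * I)
      + (((Lc : ℝ) ^ (d + 1) * stepScale d Lc (lev 1)) * (∏ i ∈ range 0, (stepScale d Lc (lev (i + 1 + 1)) * ((box (d + 1) Lc).card : ℝ)))⁻¹) •
        (stepIns₁Sym M Lc (I *ᵥ h) * O + stepIns₁Sym M Lc (I *ᵥ h) * O) + QstepSym Lc M (lev 1) * O = _
  simp only [I, O, Matrix.mul_one, Matrix.one_mulVec, Matrix.mul_zero, add_zero, smul_zero, prod_range_zero, inv_one, mul_one]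
  rfl

/-- [folklore] symmetry, THE INDUCTION STEP (centred root `hc` for §1's `stepIns₂₂Sym_comm`). -/
theorem compIns₂₂Sym_comm_step (hc : ctrOff (d + 1) Lc ∈ box (d + 1) Lc) (n : ℕ) (M : Fin (d + 1) → ℕ) [∀ μ, NeZero (M μ)] (lev : ℕ → ℕ)
    (rs : ℕ → (Fin (d + 1) → ℕ)) (h h' : ↥(pbox (towerTorus Lc (fine Lc M) n)) × Fin (d + 1) → ℝ)
    (ih : compIns₂₂Sym Lc (fine Lc M) (fun k => lev (k + 1)) (fun k => rs (k + 1)) n h h' = compIns₂₂Sym Lc (fine Lc M) (fun k => lev (k + 1)) (fun k => rs (k + 1)) n h' h) :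
    compIns₂₂Sym Lc M lev rs (n + 1) h h' = compIns₂₂Sym Lc M lev rs (n + 1) h' h := by
  rw [compIns₂₂Sym_succ, compIns₂₂Sym_succ, stepIns₂₂Sym_comm M Lc hc, ih,
    add_comm (stepIns₁Sym M Lc (compRowsSym Lc (fine Lc M) (fun k => lev (k + 1)) (fun k => rs (k + 1)) n *ᵥ h)
      * compIns₁Sym Lc (fine Lc M) (fun k => lev (k + 1)) (fun k => rs (k + 1)) n h')]

/-- [folklore] **SYMMETRIC**: `compIns₂₂Sym … n h h′ = compIns₂₂Sym … n h′ h`. -/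
theorem compIns₂₂Sym_comm (hc : ctrOff (d + 1) Lc ∈ box (d + 1) Lc) :
    ∀ (n : ℕ) (M : Fin (d + 1) → ℕ) [∀ μ, NeZero (M μ)] (lev : ℕ → ℕ) (rs : ℕ → (Fin (d + 1) → ℕ))
      (h h' : ↥(pbox (towerTorus Lc M n)) × Fin (d + 1) → ℝ),
      compIns₂₂Sym Lc M lev rs n h h' = compIns₂₂Sym Lc M lev rs n h' h
  | 0, M, _, lev, rs, h, h' => by simp only [compIns₂₂Sym_zero]
  | n + 1, M, _, lev, rs, h, h' =>
    compIns₂₂Sym_comm_step Lc hc n M lev rs h h' (compIns₂₂Sym_comm hc n (fine Lc M) (fun k => lev (k + 1)) (fun k => rs (k + 1)) h h')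

/-- [folklore] additivity in the first weight, THE INDUCTION STEP (`stepIns₂₂Sym_add_left`, `stepIns₁Sym_add`, `compIns₁Sym_add`, `ih`). -/
theorem compIns₂₂Sym_add_left_step (n : ℕ) (M : Fin (d + 1) → ℕ) [∀ μ, NeZero (M μ)] (lev : ℕ → ℕ) (rs : ℕ → (Fin (d + 1) → ℕ))
    (h₁ h₂ h' : ↥(pbox (towerTorus Lc (fine Lc M) n)) × Fin (d + 1) → ℝ)
    (ih : compIns₂₂Sym Lc (fine Lc M) (fun k => lev (k + 1)) (fun k => rs (k + 1)) n (h₁ + h₂) h'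
      = compIns₂₂Sym Lc (fine Lc M) (fun k => lev (k + 1)) (fun k => rs (k + 1)) n h₁ h' + compIns₂₂Sym Lc (fine Lc M) (fun k => lev (k + 1)) (fun k => rs (k + 1)) n h₂ h') :
    compIns₂₂Sym Lc M lev rs (n + 1) (h₁ + h₂) h' = compIns₂₂Sym Lc M lev rs (n + 1) h₁ h' + compIns₂₂Sym Lc M lev rs (n + 1) h₂ h' := by
  rw [compIns₂₂Sym_succ, compIns₂₂Sym_succ, compIns₂₂Sym_succ, ih, Matrix.mulVec_add, stepIns₂₂Sym_add_left, stepIns₁Sym_add, compIns₁Sym_add]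
  simp only [Matrix.add_mul, Matrix.mul_add, smul_add]
  abel

/-- [folklore] **ADDITIVE IN THE FIRST WEIGHT**. -/
theorem compIns₂₂Sym_add_left :
    ∀ (n : ℕ) (M : Fin (d + 1) → ℕ) [∀ μ, NeZero (M μ)] (lev : ℕ → ℕ) (rs : ℕ → (Fin (d + 1) → ℕ))
      (h₁ h₂ h' : ↥(pbox (towerTorus Lc M n)) × Fin (d + 1) → ℝ),
      compIns₂₂Sym Lc M lev rs n (h₁ + h₂) h' = compIns₂₂Sym Lc M lev rs n h₁ h' + compIns₂₂Sym Lc M lev rs n h₂ h'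
  | 0, M, _, lev, rs, h₁, h₂, h' => by simp only [compIns₂₂Sym_zero, add_zero]
  | n + 1, M, _, lev, rs, h₁, h₂, h' =>
    compIns₂₂Sym_add_left_step Lc n M lev rs h₁ h₂ h' (compIns₂₂Sym_add_left n (fine Lc M) (fun k => lev (k + 1)) (fun k => rs (k + 1)) h₁ h₂ h')

/-- [folklore] homogeneity in the first weight, THE INDUCTION STEP (push-inside types, both sides unfolded — the outer `t •` must live at the unfolded column type). -/
theorem compIns₂₂Sym_smul_left_step (n : ℕ) (M : Fin (d + 1) → ℕ) [∀ μ, NeZero (M μ)] (lev : ℕ → ℕ) (rs : ℕ → (Fin (d + 1) → ℕ)) (t : ℝ)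
    (h h' : ↥(pbox (towerTorus Lc (fine Lc M) n)) × Fin (d + 1) → ℝ)
    (ih : compIns₂₂Sym Lc (fine Lc M) (fun k => lev (k + 1)) (fun k => rs (k + 1)) n (t • h) h' = t • compIns₂₂Sym Lc (fine Lc M) (fun k => lev (k + 1)) (fun k => rs (k + 1)) n h h') :
    ((((Lc : ℝ) ^ (d + 1) * stepScale d Lc (lev 1)) * (∏ i ∈ range n, (stepScale d Lc (lev (i + 1 + 1)) * ((box (d + 1) Lc).card : ℝ)))⁻¹) * (∏ i ∈ range n, (stepScale d Lc (lev (i + 1 + 1)) * ((box (d + 1) Lc).card : ℝ)))⁻¹) •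
            (stepIns₂₂Sym M Lc (compRowsSym Lc (fine Lc M) (fun k => lev (k + 1)) (fun k => rs (k + 1)) n *ᵥ (t • h)) (compRowsSym Lc (fine Lc M) (fun k => lev (k + 1)) (fun k => rs (k + 1)) n *ᵥ h') * compRowsSym Lc (fine Lc M) (fun k => lev (k + 1)) (fun k => rs (k + 1)) n)
        + (((Lc : ℝ) ^ (d + 1) * stepScale d Lc (lev 1)) * (∏ i ∈ range n, (stepScale d Lc (lev (i + 1 + 1)) * ((box (d + 1) Lc).card : ℝ)))⁻¹) • (stepIns₁Sym M Lc (compRowsSym Lc (fine Lc M) (fun k => lev (k + 1)) (fun k => rs (k + 1)) n *ᵥ (t • h)) * compIns₁Sym Lc (fine Lc M) (fun k => lev (k + 1)) (fun k => rs (k + 1)) n h' + stepIns₁Sym M Lc (compRowsSym Lc (fine Lc M) (fun k => lev (k + 1)) (fun k => rs (k + 1)) n *ᵥ h') * compIns₁Sym Lc (fine Lc M) (fun k => lev (k + 1)) (fun k => rs (k + 1)) n (t • h))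
        + QstepSym Lc M (lev 1) * compIns₂₂Sym Lc (fine Lc M) (fun k => lev (k + 1)) (fun k => rs (k + 1)) n (t • h) h'
      = t • (((((Lc : ℝ) ^ (d + 1) * stepScale d Lc (lev 1)) * (∏ i ∈ range n, (stepScale d Lc (lev (i + 1 + 1)) * ((box (d + 1) Lc).card : ℝ)))⁻¹) * (∏ i ∈ range n, (stepScale d Lc (lev (i + 1 + 1)) * ((box (d + 1) Lc).card : ℝ)))⁻¹) •
            (stepIns₂₂Sym M Lc (compRowsSym Lc (fine Lc M) (fun k => lev (k + 1)) (fun k => rs (k + 1)) n *ᵥ h) (compRowsSym Lc (fine Lc M) (fun k => lev (k + 1)) (fun k => rs (k + 1)) n *ᵥ h') * compRowsSym Lc (fine Lc M) (fun k => lev (k + 1)) (fun k => rs (k + 1)) n)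
        + (((Lc : ℝ) ^ (d + 1) * stepScale d Lc (lev 1)) * (∏ i ∈ range n, (stepScale d Lc (lev (i + 1 + 1)) * ((box (d + 1) Lc).card : ℝ)))⁻¹) • (stepIns₁Sym M Lc (compRowsSym Lc (fine Lc M) (fun k => lev (k + 1)) (fun k => rs (k + 1)) n *ᵥ h) * compIns₁Sym Lc (fine Lc M) (fun k => lev (k + 1)) (fun k => rs (k + 1)) n h' + stepIns₁Sym M Lc (compRowsSym Lc (fine Lc M) (fun k => lev (k + 1)) (fun k => rs (k + 1)) n *ᵥ h') * compIns₁Sym Lc (fine Lc M) (fun k => lev (k + 1)) (fun k => rs (k + 1)) n h)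
        + QstepSym Lc M (lev 1) * compIns₂₂Sym Lc (fine Lc M) (fun k => lev (k + 1)) (fun k => rs (k + 1)) n h h') := by
  rw [ih, Matrix.mulVec_smul, stepIns₂₂Sym_smul_left, stepIns₁Sym_smul, compIns₁Sym_smul]
  simp only [Matrix.smul_mul, Matrix.mul_smul, smul_add, smul_smul, mul_comm t]

/-- [folklore] **HOMOGENEOUS IN THE FIRST WEIGHT**. -/
theorem compIns₂₂Sym_smul_left :
    ∀ (n : ℕ) (M : Fin (d + 1) → ℕ) [∀ μ, NeZero (M μ)] (lev : ℕ → ℕ) (rs : ℕ → (Fin (d + 1) → ℕ)) (t : ℝ)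
      (h h' : ↥(pbox (towerTorus Lc M n)) × Fin (d + 1) → ℝ),
      compIns₂₂Sym Lc M lev rs n (t • h) h' = t • compIns₂₂Sym Lc M lev rs n h h'
  | 0, M, _, lev, rs, t, h, h' => by simp only [compIns₂₂Sym_zero, smul_zero]
  | n + 1, M, _, lev, rs, t, h, h' =>
    compIns₂₂Sym_smul_left_step Lc n M lev rs t h h' (compIns₂₂Sym_smul_left n (fine Lc M) (fun k => lev (k + 1)) (fun k => rs (k + 1)) t h h')

/-- [folklore] additive in the second weight (by symmetry). -/
theorem compIns₂₂Sym_add_right (hc : ctrOff (d + 1) Lc ∈ box (d + 1) Lc) (n : ℕ) (M : Fin (d + 1) → ℕ) [∀ μ, NeZero (M μ)] (lev : ℕ → ℕ)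
    (rs : ℕ → (Fin (d + 1) → ℕ)) (h h₁ h₂ : ↥(pbox (towerTorus Lc M n)) × Fin (d + 1) → ℝ) :
    compIns₂₂Sym Lc M lev rs n h (h₁ + h₂) = compIns₂₂Sym Lc M lev rs n h h₁ + compIns₂₂Sym Lc M lev rs n h h₂ := by
  rw [compIns₂₂Sym_comm Lc hc n M lev rs, compIns₂₂Sym_add_left, compIns₂₂Sym_comm Lc hc n M lev rs h₁, compIns₂₂Sym_comm Lc hc n M lev rs h₂]

/-- [folklore] homogeneous in the second weight (by symmetry). -/
theorem compIns₂₂Sym_smul_right (hc : ctrOff (d + 1) Lc ∈ box (d + 1) Lc) (n : ℕ) (M : Fin (d + 1) → ℕ) [∀ μ, NeZero (M μ)] (lev : ℕ → ℕ)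
    (rs : ℕ → (Fin (d + 1) → ℕ)) (t : ℝ) (h h' : ↥(pbox (towerTorus Lc M n)) × Fin (d + 1) → ℝ) :
    compIns₂₂Sym Lc M lev rs n h (t • h') = t • compIns₂₂Sym Lc M lev rs n h h' := by
  rw [compIns₂₂Sym_comm Lc hc n M lev rs, compIns₂₂Sym_smul_left, compIns₂₂Sym_comm Lc hc n M lev rs h']

/-- [folklore] **`compIns₂Sym_add` — THE POLARISATION IDENTITY OF THE SYM COMPOSITE SECOND JET**: `compIns₂Sym … n (h + h′) = compIns₂Sym … n h +
(compIns₂₂Sym … n h h′ + compIns₂₂Sym … n h h′) + compIns₂Sym … n h′`. -/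
theorem compIns₂Sym_add (hc : ctrOff (d + 1) Lc ∈ box (d + 1) Lc) (n : ℕ) (M : Fin (d + 1) → ℕ) [∀ μ, NeZero (M μ)] (lev : ℕ → ℕ)
    (rs : ℕ → (Fin (d + 1) → ℕ)) (h h' : ↥(pbox (towerTorus Lc M n)) × Fin (d + 1) → ℝ) :
    compIns₂Sym Lc M lev rs n (h + h')
      = compIns₂Sym Lc M lev rs n h + (compIns₂₂Sym Lc M lev rs n h h' + compIns₂₂Sym Lc M lev rs n h h') + compIns₂Sym Lc M lev rs n h' := by
  rw [compIns₂Sym, compIns₂Sym, compIns₂Sym, compIns₂₂Sym_add_left, compIns₂₂Sym_add_right Lc hc, compIns₂₂Sym_add_right Lc hc,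
    compIns₂₂Sym_comm Lc hc n M lev rs h' h]
  abel

end Tower

end Summit.QuantumFields.BalabanUV.Beta.FP.TorusCompositeCovarianceTwoPolarSym

end
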